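import Literature.NumberTheory.EllipticCurves.ComplexMultiplicationDeuringLocal
import Literature.NumberTheory.DiophantineGeometry.MinimalDiscriminantRingOfIntegersProofs
import Literature.NumberTheory.QuadraticForms.HilbertSymbolRatOdd
import Mathlib.NumberTheory.Padics.HeightOneSpectrum
import Mathlib.NumberTheory.NumberField.Norm
import Mathlib.RingTheory.RamificationInertia.Inertia
import Mathlib.RingTheory.DedekindDomain.Factorization
import Mathlib.NumberTheory.Padics.PadicVal.Basic
import HarnessLib

/-!
# The `p`-adic valuation of a field norm, place by place (row T-MIL-ODD, FILE C-1)
# (seat n1011-p01 GEN 6; stage C = glue + assembly of the odd Tamagawa identity)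

HONEST FRAMING (cell `b2b-bsdres`, run/shared/lean/b2b/bsd-rank1-residual/, verbatim in every
file): the goal of the cell is to DELETE the COMBINATION-SHAPED residual classes of the
Birch–Swinnerton-Dyer formula for ALL analytic-rank `≤ 1` elliptic curves over `ℚ` — "full BSD
formula for every rank `≤ 1` curve in class `C`" assembled STRICTLY from published theorems — so
that the rank-`≤ 1` remainder becomes exactly the CONSTRUCTION-SHAPED classes, which are TYPED
(missing-input `Prop`s), NOT attempted. This is not "finishing BSD". Sub-classes X3♯(M) / X4(M)
(additive, potentially multiplicative prime; base-change-and-descend): a RESEARCH ROUTE; they stay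
CONSTRUCTION-SHAPED; nothing is booked by this file; no mark / label moved. THEOREMS ONLY: no
definition, no named fact, no `sorry`.

## What and why (row T-MIL-ODD, `cells/n1011/skel/T-MIL-ODD.md` §1 "Archimedean / global glue")

The odd part of Milne's quadratic BSD-quotient identity — hypothesis `hodd` of the tree's
`WeierstrassCurve.bsdRHS_baseChange_quadratic_of_padicValRat`
(`Literature/…/BSDQuadraticDescentTorsionOddPartProofs.lean`), i.e. for every odd prime `p`
`v_p(|N_{K/ℚ}(C'.u)| · ∏_w c_w(W')) = v_p(|C_d.u| · ∏_ℓ c_ℓ(W) · ∏_ℓ c_ℓ(W_d))` — contains, besides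
the Tamagawa numbers, the two scaling units `C'.u ∈ K^×` and `C_d.u ∈ ℚ^×` of the minimal models
`W' = C' • W_K`, `W_d = C_d • W^{(d_K)}`. Stage A of the row computed their valuations PLACE BY
PLACE (`QuadraticBaseChangeTwistTransfer.valuation_u_pow_twelve_of_isMinimalAt`,
`QuadraticTwistRamifiedPotMult.valuation_u_eq_exp_neg_one_of_mult_twist`, in Mathlib's
multiplicative currency `w.valuation K x = exp(−ord_w x)`). This file is the GLUE from those local
valuations to the `p`-adic valuation of the NORM, for an arbitrary number field `K`:

* `valuation_rat_eq_exp_neg_padicValRat`, `padicValRat_eq_neg_log_valuation` — on `ℚ`, at the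
  place `v ↔ p`: `v(x) = exp(−ord_p x)` (Mathlib's `valuation_equiv_padicValuation` made an
  equality: both valuations send `p` to `exp(−1)`);
* `absNorm_asIdeal_eq_primesEquiv_pow`, `padicValNat_absNorm_asIdeal` — `N(𝔭_w) = ℓ_w^{f_w}`
  (Mathlib `Ideal.absNorm_pow_inertiaDeg`), so `ord_p N(𝔭_w) = f_w` if `w ∣ p` and `0` otherwise;
* `padicValNat_absNorm_span_singleton_eq_finsum` — for `a ∈ 𝓞 K`, `a ≠ 0`:
  `ord_p N((a)) = Σ_w ord_p N(𝔭_w) · n_w(a)` from the factorisation `(a) = ∏_w 𝔭_w^{n_w(a)}`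
  (Mathlib `Ideal.finprod_heightOneSpectrum_factorization`) and the multiplicativity of the
  absolute norm; `valuation_algebraMap_eq_exp_neg_count` — `|a|_w = exp(−n_w(a))`;
* `padicValRat_norm_eq_sum_fibre`, `padicValRat_abs_norm_eq_sum_fibre` — **for every `u ∈ K^×`:
  `ord_p N_{K/ℚ}(u) = ord_p |N_{K/ℚ}(u)| = Σ_{w ∣ p} f(w|p) · ord_w(u)`**, the sum over the finite
  fibre `{w : w ∩ 𝓞 ℚ = v}` of the tree's `finite_setOf_under_eq_of_numberField` (the currency of
  x11b's `X11b/TamagawaQuadraticPlaces`), `ord_w(u) := −log(w.valuation K u)`,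
  `f(w|p) = w.asIdeal.inertiaDeg (𝓞 ℚ)`; via `u = a/b` with `a, b ∈ 𝓞 K`
  (`IsFractionRing.div_surjective`), `N((a)) = |N_{K/ℚ}(a)|` (Mathlib `Ideal.absNorm_span_singleton`,
  `Algebra.coe_norm_int`).

In print this is the compatibility of the norm with the absolute values, `|N_{K/ℚ}(u)|_p^{-1} =
∏_{w∣p} |u|_w^{-1}` with `|·|_w` normalised by `N(𝔭_w) = p^{f_w}` (Neukirch, *Algebraic Number
Theory*, Ch. III (1.2)–(1.3) and Ch. I (8.2); Cassels–Fröhlich Ch. II §11). HONEST LIMITS: TOOL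
theorems (pure algebraic number theory, no curve); closes no class; discharges no fact by itself —
the assembly (`QuadraticBaseChangeOddTamagawaAssembly`, FILE C-2) consumes them.
-/

noncomputable section

open scoped Classical NumberField

open NumberField IsDedekindDomain Rat.HeightOneSpectrum WithZero

namespace Summit.BirchSwinnertonDyer.Rank1Residual.AdditivePotMult

/-! ## §1 The rational side: `v(x) = exp(−ord_p x)` -/

section RatSide

variable (v : HeightOneSpectrum (𝓞 ℚ))

/-- **`v(x) = exp(−ord_p x)` on `ℚ`** at the finite place `v ↔ p` of `𝓞 ℚ`, for `x ≠ 0`: Mathlib's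
`Rat.HeightOneSpectrum.valuation_equiv_padicValuation` gives the two valuations EQUIVALENT; both are
`ℤᵐ⁰`-valued and send `p` to `exp(−1)` (`p` is a uniformiser of `v`, tree
`RatPlace.intValuation_natGenerator`), so they agree on `x` and on `p^{ord_p x}` alike.
(The tree's `NeronLocalHeightCompletion.valuation_eq_exp_neg_padicValRat` is the same statement
for `HeightOneSpectrum ℤ`.) [cite: NeukirchANT1999, Ch. II (3.3)–(3.5) and Ch. I (8.2)] -/
theorem valuation_rat_eq_exp_neg_padicValRat {x : ℚ} (hx : x ≠ 0) :
    v.valuation ℚ x = exp (-padicValRat (primesEquiv v : ℕ) x) := by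
  haveI hp : Fact (Nat.Prime ((primesEquiv v : Nat.Primes) : ℕ)) := ⟨(primesEquiv v).2⟩
  have hequiv := valuation_equiv_padicValuation v
  set n : ℤ := padicValRat (primesEquiv v : ℕ) x with hn
  -- `p`-adic valuation of `x` and of `p ^ n`
  have h2x : Rat.padicValuation (primesEquiv v) x = exp (-n) := by
    simp [Rat.padicValuation, hx, hn]
  have h2p : Rat.padicValuation (primesEquiv v) (((primesEquiv v : ℕ) : ℚ) ^ n) = exp (-n) := by
    rw [map_zpow₀, Rat.padicValuation_self, ← exp_zsmul]
    simp
  -- `v`-adic valuation of `p ^ n`: `p = natGenerator v` is a uniformiser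
  have hvp : v.valuation ℚ ((primesEquiv v : ℕ) : ℚ) = exp (-1 : ℤ) := by
    have h : v.valuation ℚ (algebraMap (𝓞 ℚ) ℚ ((natGenerator v : ℕ) : 𝓞 ℚ)) = exp (-1 : ℤ) := by
      rw [HeightOneSpectrum.valuation_of_algebraMap]
      exact Literature.NumberTheory.QuadraticForms.RatPlace.intValuation_natGenerator v
    rw [map_natCast] at h
    exact h
  have h1p : v.valuation ℚ (((primesEquiv v : ℕ) : ℚ) ^ n) = exp (-n) := by
    rw [map_zpow₀, hvp, ← exp_zsmul]
    simp
  rw [← h1p]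
  exact (hequiv.eq_iff).mpr (h2x.trans h2p.symm)

/-- `ord_p x = −log v(x)` for `x ∈ ℚ^×` at `v ↔ p` (the additive reading of
`valuation_rat_eq_exp_neg_padicValRat`). [folklore] -/
theorem padicValRat_eq_neg_log_valuation {x : ℚ} (hx : x ≠ 0) :
    padicValRat (primesEquiv v : ℕ) x = -log (v.valuation ℚ x) := by
  rw [valuation_rat_eq_exp_neg_padicValRat v hx, log_exp, neg_neg]

end RatSide

/-! ## §2 The absolute norm of a prime of `𝓞 K` -/

section Places

variable {K : Type*} [Field K] [NumberField K] (w : HeightOneSpectrum (𝓞 K))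

/-- **`N(𝔭_w) = ℓ_w^{f(w|ℓ_w)}`**: the absolute norm of the prime `𝔭_w` of `𝓞 K` is the rational
prime `ℓ_w` under it (`primesEquiv (w ∩ 𝓞 ℚ)`) to the residue degree `f = w.asIdeal.inertiaDeg (𝓞 ℚ)`
(Mathlib `Ideal.absNorm_pow_inertiaDeg` with `N(𝔭_v) = p_v` on `𝓞 ℚ`, tree
`MinimalDiscriminant.absNorm_asIdeal_eq_natGenerator`). [cite: NeukirchANT1999, Ch. I, Prop. (8.2)] -/
theorem absNorm_asIdeal_eq_primesEquiv_pow :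
    Ideal.absNorm w.asIdeal =
      (primesEquiv (w.under (𝓞 ℚ)) : ℕ) ^ w.asIdeal.inertiaDeg (𝓞 ℚ) := by
  haveI : w.asIdeal.LiesOver (w.under (𝓞 ℚ)).asIdeal := ⟨rfl⟩
  rw [← Ideal.absNorm_pow_inertiaDeg (w.under (𝓞 ℚ)).asIdeal w.asIdeal,
    Literature.NumberTheory.DiophantineGeometry.MinimalDiscriminant.absNorm_asIdeal_eq_natGenerator]
  rfl

/-- `w` lies above `v` iff the rational primes under `w` and `v` coincide (`primesEquiv` is a
bijection). [folklore] -/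
theorem primesEquiv_under_eq_iff (v : HeightOneSpectrum (𝓞 ℚ)) :
    (primesEquiv (w.under (𝓞 ℚ)) : ℕ) = (primesEquiv v : ℕ) ↔ w.under (𝓞 ℚ) = v := by
  constructor
  · intro h
    exact (primesEquiv (R := 𝓞 ℚ)).injective (Subtype.ext h)
  · rintro rfl; rfl

/-- **`ord_p N(𝔭_w) = f(w|p)` if `w ∣ p`, `= 0` otherwise** (`N(𝔭_w) = ℓ_w^{f_w}` with `ℓ_w`
prime). [cite: NeukirchANT1999, Ch. I, Prop. (8.2)] -/
theorem padicValNat_absNorm_asIdeal (v : HeightOneSpectrum (𝓞 ℚ)) :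
    padicValNat (primesEquiv v : ℕ) (Ideal.absNorm w.asIdeal) =
      if w.under (𝓞 ℚ) = v then w.asIdeal.inertiaDeg (𝓞 ℚ) else 0 := by
  haveI hp : Fact (Nat.Prime ((primesEquiv v : Nat.Primes) : ℕ)) := ⟨(primesEquiv v).2⟩
  haveI hℓ : Fact (Nat.Prime ((primesEquiv (w.under (𝓞 ℚ)) : Nat.Primes) : ℕ)) :=
    ⟨(primesEquiv (w.under (𝓞 ℚ))).2⟩
  rw [absNorm_asIdeal_eq_primesEquiv_pow, padicValNat.pow]
  split_ifs with h
  · rw [(primesEquiv_under_eq_iff w v).mpr h, padicValNat_self, mul_one]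
  · rw [padicValNat_primes (fun h' => h ((primesEquiv_under_eq_iff w v).mp h'.symm)), mul_zero]

end Places

/-! ## §3 Integral elements: `ord_p N((a)) = Σ_w ord_p N(w) · n_w(a)` -/

section Integral

variable {K : Type*} [Field K] [NumberField K]

/-- `ord_p` of a finite product of non-zero naturals is the (finite) sum of the `ord_p`
(`padicValNat.mul` along `Finset.induction_on`; the same bookkeeping as x11b's private
`padicValNat_finsetProd`, in `finprod`/`finsum` form). [folklore] -/
theorem padicValNat_finprod_eq_finsum {ι : Type*} (p : ℕ) [Fact p.Prime] {g : ι → ℕ}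
    (hg : Function.HasFiniteMulSupport g) (hg0 : ∀ i, g i ≠ 0) :
    padicValNat p (∏ᶠ i, g i) = ∑ᶠ i, padicValNat p (g i) := by
  classical
  have hsub : Function.support (fun i => padicValNat p (g i)) ⊆ (hg.toFinset : Set ι) := by
    intro i hi
    rw [Set.Finite.coe_toFinset, Function.mem_mulSupport]
    intro h1
    exact hi (by simp [h1])
  rw [finprod_eq_prod_of_mulSupport_toFinset_subset g hg (subset_refl _),
    finsum_eq_sum_of_support_subset _ hsub]
  induction hg.toFinset using Finset.induction_on with
  | empty => simp
  | insert a s ha ih =>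
    rw [Finset.prod_insert ha, Finset.sum_insert ha,
      padicValNat.mul (hg0 a) (Finset.prod_ne_zero_iff.mpr fun i _ => hg0 i), ih]

/-- `|a|_w = exp(−n_w(a))` for `a ∈ 𝓞 K`, `a ≠ 0`, `n_w(a)` the exponent of `𝔭_w` in `(a)` (Mathlib's
definition of the `w`-adic valuation, `intValuation_if_neg`, read on `K`). [folklore] -/
theorem valuation_algebraMap_eq_exp_neg_count (w : HeightOneSpectrum (𝓞 K)) {a : 𝓞 K}
    (ha : a ≠ 0) :
    w.valuation K (a : K) =
      exp (-((Associates.mk w.asIdeal).count (Associates.mk (Ideal.span {a})).factors : ℤ)) := by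
  rw [show (a : K) = algebraMap (𝓞 K) K a from rfl, HeightOneSpectrum.valuation_of_algebraMap,
    HeightOneSpectrum.intValuation_if_neg _ ha]

/-- **`ord_p N((a)) = Σ_w ord_p N(𝔭_w) · n_w(a)`** for `a ∈ 𝓞 K`, `a ≠ 0`: the factorisation
`(a) = ∏_w 𝔭_w^{n_w(a)}` (Mathlib `Ideal.finprod_heightOneSpectrum_factorization`), the
multiplicativity of the absolute norm (`map_finprod`), and `padicValNat_finprod_eq_finsum`
(`N(𝔭_w) > 1`, so the `finprod` has the same finite support). [cite: NeukirchANT1999, Ch. I (3.9) with (6.2)–(6.3)] -/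
theorem padicValNat_absNorm_span_singleton_eq_finsum (p : ℕ) [Fact p.Prime] {a : 𝓞 K}
    (ha : a ≠ 0) :
    padicValNat p (Ideal.absNorm (Ideal.span {a})) =
      ∑ᶠ w : HeightOneSpectrum (𝓞 K), padicValNat p (Ideal.absNorm w.asIdeal) *
        (Associates.mk w.asIdeal).count (Associates.mk (Ideal.span ({a} : Set (𝓞 K)))).factors := by
  set I : Ideal (𝓞 K) := Ideal.span {a} with hIdef
  have hI : I ≠ 0 := by
    rw [Ideal.zero_eq_bot, Ne, Ideal.span_singleton_eq_bot]
    exact ha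
  have hfin : Function.HasFiniteMulSupport
      fun w : HeightOneSpectrum (𝓞 K) => w.maxPowDividing I := Ideal.hasFiniteMulSupport hI
  -- `N(I) = ∏ᶠ_w N(w)^{n_w}`
  have h1 : Ideal.absNorm I =
      ∏ᶠ w : HeightOneSpectrum (𝓞 K), Ideal.absNorm w.asIdeal ^
        (Associates.mk w.asIdeal).count (Associates.mk I).factors := by
    conv_lhs => rw [← Ideal.finprod_heightOneSpectrum_factorization hI]
    rw [map_finprod Ideal.absNorm hfin]
    refine finprod_congr fun w => ?_
    simp only [HeightOneSpectrum.maxPowDividing, map_pow]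
  have hg : Function.HasFiniteMulSupport fun w : HeightOneSpectrum (𝓞 K) =>
      Ideal.absNorm w.asIdeal ^ (Associates.mk w.asIdeal).count (Associates.mk I).factors := by
    refine hfin.subset fun w hw => ?_
    rw [Function.mem_mulSupport] at hw ⊢
    intro h1'
    apply hw
    have hcnt : (Associates.mk w.asIdeal).count (Associates.mk I).factors = 0 := by
      by_contra hne
      have hle : w.asIdeal ^ (Associates.mk w.asIdeal).count (Associates.mk I).factors ≤ w.asIdeal :=
        Ideal.pow_le_self hne
      change w.asIdeal ^ (Associates.mk w.asIdeal).count (Associates.mk I).factors = 1 at h1'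
      rw [h1', Ideal.one_eq_top, top_le_iff] at hle
      exact w.isPrime.ne_top hle
    rw [hcnt, pow_zero]
  have hg0 : ∀ w : HeightOneSpectrum (𝓞 K),
      Ideal.absNorm w.asIdeal ^ (Associates.mk w.asIdeal).count (Associates.mk I).factors ≠ 0 :=
    fun w => pow_ne_zero _ (by
      rw [Ne, Ideal.absNorm_eq_zero_iff]; exact w.ne_bot)
  rw [h1, padicValNat_finprod_eq_finsum p hg hg0]
  refine finsum_congr fun w => ?_
  rw [padicValNat.pow, mul_comm]

end Integral

/-! ## §4 The fibre form and arbitrary non-zero elements -/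

section Fibre

variable {K : Type*} [Field K] [NumberField K] (v : HeightOneSpectrum (𝓞 ℚ))

/-- **`ord_p N((a)) = Σ_{w ∣ p} f(w|p) · n_w(a)`** (`a ∈ 𝓞 K`, `a ≠ 0`), the sum over the finite
fibre `{w : w ∩ 𝓞 ℚ = v}`, `v ↔ p` (tree `finite_setOf_under_eq_of_numberField`): the terms of
`padicValNat_absNorm_span_singleton_eq_finsum` off the fibre vanish (`padicValNat_absNorm_asIdeal`).
[cite: NeukirchANT1999, Ch. I, Prop. (8.2) and (3.9)] -/
theorem padicValNat_absNorm_span_singleton_eq_sum_fibre {a : 𝓞 K} (ha : a ≠ 0) :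
    (padicValNat (primesEquiv v : ℕ) (Ideal.absNorm (Ideal.span {a})) : ℤ) =
      ∑ w ∈ (HeightOneSpectrum.finite_setOf_under_eq_of_numberField (K := K) v).toFinset,
        (w.asIdeal.inertiaDeg (𝓞 ℚ) : ℤ) *
          ((Associates.mk w.asIdeal).count (Associates.mk (Ideal.span ({a} : Set (𝓞 K)))).factors : ℤ) := by
  haveI hp : Fact (Nat.Prime ((primesEquiv v : Nat.Primes) : ℕ)) := ⟨(primesEquiv v).2⟩
  set F := (HeightOneSpectrum.finite_setOf_under_eq_of_numberField (K := K) v).toFinset with hF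
  have hmemF : ∀ w, w ∈ F ↔ w.under (𝓞 ℚ) = v := fun w => by
    simp [hF, Set.Finite.mem_toFinset]
  rw [padicValNat_absNorm_span_singleton_eq_finsum _ ha]
  have hsupp : Function.support (fun w : HeightOneSpectrum (𝓞 K) =>
      padicValNat (primesEquiv v : ℕ) (Ideal.absNorm w.asIdeal) *
        (Associates.mk w.asIdeal).count (Associates.mk (Ideal.span ({a} : Set (𝓞 K)))).factors) ⊆
      (F : Set (HeightOneSpectrum (𝓞 K))) := by
    intro w hw
    rw [Function.mem_support, padicValNat_absNorm_asIdeal w v] at hw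
    rw [Finset.mem_coe, hmemF]
    by_contra h
    rw [if_neg h, zero_mul] at hw
    exact hw rfl
  rw [finsum_eq_sum_of_support_subset _ hsupp, Nat.cast_sum]
  refine Finset.sum_congr rfl fun w hw => ?_
  rw [padicValNat_absNorm_asIdeal w v, if_pos ((hmemF w).mp hw), Nat.cast_mul]

/-- **`ord_p N_{K/ℚ}(a) = Σ_{w ∣ p} f(w|p) · ord_w(a)`** for integral `a ≠ 0`, with
`ord_w(a) = −log |a|_w`: `N_{K/ℚ}(a) = N_{𝓞K/ℤ}(a)` (Mathlib `Algebra.coe_norm_int`) and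
`N((a)) = |N(a)|` (`Ideal.absNorm_span_singleton`). [cite: NeukirchANT1999, Ch. III, Prop. (1.2)–(1.3) (norm compatibility of the normalised absolute values)] -/
theorem padicValRat_norm_algebraMap_eq_sum_fibre {a : 𝓞 K} (ha : a ≠ 0) :
    padicValRat (primesEquiv v : ℕ) (Algebra.norm ℚ (a : K)) =
      ∑ w ∈ (HeightOneSpectrum.finite_setOf_under_eq_of_numberField (K := K) v).toFinset,
        (w.asIdeal.inertiaDeg (𝓞 ℚ) : ℤ) * (-log (w.valuation K (a : K))) := by
  haveI hp : Fact (Nat.Prime ((primesEquiv v : Nat.Primes) : ℕ)) := ⟨(primesEquiv v).2⟩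
  rw [← Algebra.coe_norm_int, padicValRat.of_int,
    show padicValInt (primesEquiv v : ℕ) (Algebra.norm ℤ a) =
      padicValNat (primesEquiv v : ℕ) (Ideal.absNorm (Ideal.span {a})) by
      rw [Ideal.absNorm_span_singleton]; rfl,
    padicValNat_absNorm_span_singleton_eq_sum_fibre v ha]
  refine Finset.sum_congr rfl fun w _ => ?_
  rw [valuation_algebraMap_eq_exp_neg_count w ha, log_exp, neg_neg]

/-- **`ord_p N_{K/ℚ}(u) = Σ_{w ∣ p} f(w|p) · ord_w(u)` for every `u ∈ K^×`** (`ord_w(u) =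
−log(w.valuation K u)`), by writing `u = a/b` with `a, b ∈ 𝓞 K` (`IsFractionRing.div_surjective`)
and the integral case on `a` and `b` (norm and valuations are multiplicative). This is the
`p`-component of `|N_{K/ℚ}(u)| = ∏_w N(𝔭_w)^{ord_w(u)}`.
[cite: NeukirchANT1999, Ch. III, Prop. (1.2)–(1.3) (norm compatibility of the normalised absolute values)] -/
theorem padicValRat_norm_eq_sum_fibre {u : K} (hu : u ≠ 0) :
    padicValRat (primesEquiv v : ℕ) (Algebra.norm ℚ u) =
      ∑ w ∈ (HeightOneSpectrum.finite_setOf_under_eq_of_numberField (K := K) v).toFinset,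
        (w.asIdeal.inertiaDeg (𝓞 ℚ) : ℤ) * (-log (w.valuation K u)) := by
  haveI hp : Fact (Nat.Prime ((primesEquiv v : Nat.Primes) : ℕ)) := ⟨(primesEquiv v).2⟩
  obtain ⟨a, b, hb, rfl⟩ := IsFractionRing.div_surjective (A := 𝓞 K) u
  have hb0 : b ≠ 0 := nonZeroDivisors.ne_zero hb
  have ha0 : a ≠ 0 := by
    rintro rfl
    exact hu (by simp)
  have haK : (algebraMap (𝓞 K) K a) ≠ 0 := by
    simpa using ha0
  have hbK : (algebraMap (𝓞 K) K b) ≠ 0 := by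
    simpa using hb0
  have hNa : Algebra.norm ℚ (algebraMap (𝓞 K) K a) ≠ 0 := Algebra.norm_ne_zero_iff.mpr haK
  have hNb : Algebra.norm ℚ (algebraMap (𝓞 K) K b) ≠ 0 := Algebra.norm_ne_zero_iff.mpr hbK
  have hN : Algebra.norm ℚ (algebraMap (𝓞 K) K a / algebraMap (𝓞 K) K b) =
      Algebra.norm ℚ (algebraMap (𝓞 K) K a) / Algebra.norm ℚ (algebraMap (𝓞 K) K b) := by
    rw [eq_div_iff hNb, ← map_mul, div_mul_cancel₀ _ hbK]
  rw [hN, padicValRat.div hNa hNb,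
    show algebraMap (𝓞 K) K a = (a : K) from rfl, show algebraMap (𝓞 K) K b = (b : K) from rfl,
    padicValRat_norm_algebraMap_eq_sum_fibre v ha0, padicValRat_norm_algebraMap_eq_sum_fibre v hb0,
    ← Finset.sum_sub_distrib]
  refine Finset.sum_congr rfl fun w _ => ?_
  have hva : w.valuation K (a : K) ≠ 0 := (Valuation.ne_zero_iff _).mpr haK
  have hvb : w.valuation K (b : K) ≠ 0 := (Valuation.ne_zero_iff _).mpr hbK
  rw [map_div₀, log_div hva hvb]
  ring

/-- **`ord_p |N_{K/ℚ}(u)| = Σ_{w ∣ p} f(w|p) · ord_w(u)`** (`u ∈ K^×`) — the form consumed by the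
odd-Tamagawa assembly (FILE C-2), where `|N_{K/ℚ}(C'.u)|` is the unit term of Milne's identity.
[cite: NeukirchANT1999, Ch. III, Prop. (1.2)–(1.3) (norm compatibility of the normalised absolute values)] -/
theorem padicValRat_abs_norm_eq_sum_fibre {u : K} (hu : u ≠ 0) :
    padicValRat (primesEquiv v : ℕ) |Algebra.norm ℚ u| =
      ∑ w ∈ (HeightOneSpectrum.finite_setOf_under_eq_of_numberField (K := K) v).toFinset,
        (w.asIdeal.inertiaDeg (𝓞 ℚ) : ℤ) * (-log (w.valuation K u)) := by
  rw [← padicValRat_norm_eq_sum_fibre v hu]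
  rcases abs_choice (Algebra.norm ℚ u) with h | h <;> rw [h]
  exact padicValRat.neg _

end Fibre

end Summit.BirchSwinnertonDyer.Rank1Residual.AdditivePotMult

end
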